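import Literature.MathematicalPhysics.QuantumFieldTheory.Balaban1983to89.B9Ineq349SiteFromBlocks
import Literature.MathematicalPhysics.QuantumFieldTheory.Balaban1983to89.B9Thm311DeltaPrimeSymm
import Literature.MathematicalPhysics.QuantumFieldTheory.Balaban1983to89.B11TracePairingLetters
import Literature.MathematicalPhysics.QuantumFieldTheory.Balaban1983to89.MatrixNorms
import Literature.MathematicalPhysics.QuantumFieldTheory.Balaban1983to89.Node00.OpsYRecordV4

/-!
# `Balaban1983to89.B9Ineq349SiteAdjoint` — T. Bałaban, *Propagators for lattice gauge theories in a background field*, Commun. Math. Phys. **99** (1985)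
# 389–434 [Balaban1985BackgroundPropagators], (3.49) p. 399 with (3.8), (3.18)–(3.19), (3.25): THE ADJOINT-SIDE INPUT OF THE (3.49) DERIVATION
# (`B9Ineq349SiteComposite.Right342At`) DERIVED at the record fibre `M_N(ℂ)` from the LEFT (3.42) schema and the printed SYMMETRIES — `G′(U)` symmetric,
# `Q′*(U)` the adjoint of `Q′(U)`, `∇*_U` the adjoint of `∇_U` (unitary transporters) — with the dimension constant `N`; hence ROW 25 from the
# (3.42)-at-`Q′*δ` schema, the block-complete (3.48) and the symmetry of `G′(U)` alone

statement-level skeleton of published theorems with citation tags; proofs where landed; nothing here is a claim about the Yang–Mills mass gap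

THE PRINT.  p. 392 (3.8): *«D* is the adjoint of D»*; p. 393 (3.18)–(3.19): `Q′(U)`, `Q′*(U)` (the distant argument parallel-transported; `Q′*` the
adjoint of `Q′` for the block pairing, [4] (2.69)); p. 394 (3.21)–(3.25): `R(U)` an ORTHOGONAL projection, `G′(U) = (Δ′_a(U))⁻¹` with `Δ′_a(U)` symmetric
positive («it can be easily shown that the operator Δ′_a is positive»); p. 399 (3.49) and its derivation «using again Lemma 2.1» (GAPS G-B9-12): the
right factor `Q′G′D*^b` of `P = G′Q′*(Q′G′²Q′*)⁻¹Q′G′` is the ADJOINT of the left factor `D^bG′Q′*`, so Theorem 3.1's bound for the latter bounds the former.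

WHY THIS FILE.  `B9Ineq349SiteFromBlocks.stmt349Printed_site_of_blockSchemas` (dag-n06-i, p497981) derives row 25 from THREE block-complete inputs,
the second of which — `Right342At`, the (3.42)-type bounds for the adjoint-side factor `W(y₂)·(Q′_UG′_UD*^b_U(δ_{x′}⊗E))(y₂)` — was LOCATED as
«print gets it from (3.42) by self-adjointness, not typed for the abstract letter».  At the record fibre `𝔸 = M_N(ℂ)` the symmetry vocabulary IS typed
(n06-j's `B9Thm311ReadingCoords`: the weighted trace pairing `trIP`, `IsSymmTr`, `IsAdjTr`; `B9Thm311AdjointAtLetters.isAdjTr_QpY_QpsY` — `Q′*(U)` IS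
the `W`-adjoint of `Q′(U)` for unitary transporters; `B9Eq39Adjoint.sum_covD_mul` — `D*` IS the adjoint of `D`).  This file closes the location:
`Right342At` FOLLOWS from `Left342At` (at the swapped blocks) plus `IsSymmTr 1 (G′(U))`, for unitary-valued `U` and transporters, with constant `N·B₀`.

WHAT IS PROVED (sorry-free).
* §1 matrix analysis on `M_N(ℂ)` (L²-operator norm): `abs_re_trace_le_N` (= `B11TracePairingLetters.abs_re_trace_le`), `abs_re_trace_conjTranspose_mul_le`
  (`|Re tr(YᴴE)| ≤ N‖Y‖‖E‖`), ★ `opNorm_le_of_re_trace` (`‖X‖ ≤ c` once `Re tr(FᴴX) ≤ c` for all `‖F‖ ≤ 1` — tested at `F = X∕‖X‖`, Hilbert–Schmidt ≥ operator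
  norm, `MatrixNorms`).
* §2 the pairing bookkeeping: `trIP_comm` (dag-n06-j's `re_trace_conjTranspose_mul_comm`), `trIP_deltaY_left ∕ _right` (a delta picks one term),
  ★ `trIP_cdS_left : ⟨∇_{U,μ}Φ, Ψ⟩ = ⟨Φ, ∇*_{U,μ}Ψ⟩` ((3.8) for the trace pairing — the real part of dag-n06-j's `B9Thm311DeltaPrimeSymm.sum_trace_mul_cdsS`).
* §3 ★★ `W_mul_re_trace_eq` — THE ADJOINT IDENTITY: `W(y₂)·Re tr(Fᴴ·(Q′_UG′_Uφ)(y₂)) = ⟨G′_UQ′*_U(δ_{y₂}⊗F), φ⟩` for `G′(U)` symmetric and `Q′*` the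
  `W`-adjoint of `Q′`; with `φ = δ_{x′}⊗E` resp. `∇*_{U,ν}(δ_{x′}⊗E)` the right side is `Re tr(Yᴴ E)` for `Y = (G′Q′*(δ_{y₂}⊗F))(x′)` resp.
  `(∇_{U,ν}G′Q′*(δ_{y₂}⊗F))(x′)` — the LEFT factor at the swapped blocks.
* §4 ★★★ `right342At_of_left342At` — for `U` and the site transporters unitary-valued and `G′(U)` `trIP`-symmetric: `Left342At i parS Gp U B₀ δ₀ →
  Right342At i parS Gp U (N·B₀) δ₀`; ★★★ `thm31SiteSchemas_of_left` and `stmt349Printed_site_of_leftSchema_symm` — ROW 25 at the record fibre from the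
  LEFT (3.42) schema family, the block-complete (3.48) family and the family of symmetries `IsSymmTr 1 ((𝔏 x).Gp U)` (print's «Δ′_a symmetric»),
  for `G ≤ U(N)`-valued configurations and transporters (`(3.35)`: U is G-valued).
* §6 at def-Y's v4 record (`Node00.OpsYRecordV4`, symmetrised transporters `parSymY`): `isSymmTr_ringInverse`, ★★ `isSymmTr_GpY_parSymY` (def-Y's
  `G′(U) = (Δ′_a(U))⁻¹` over `parSymY` IS `trIP`-symmetric for `G ≤ U(N)`-valued `U` — dag-n06-j's `deltaPrimeAY'_isSymmTr` + `deltaPrimeAY'_eq_of_inv_symm`,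
  the inverse inherits), `Thm31LeftSchema`, `thm31LeftSchemaSymm_lettersYOfRecordV4`, ★★★ `stmt349Printed_site_lettersYOfRecordV4_of_left` — ROW 25 AT THE
  v4 RECORD from the LEFT (3.42) schema and the block-complete (3.48) ONLY (adjoint side and symmetry now THEOREMS).

HONEST SCOPE.  Exact linear algebra + the dimension bound `|tr M| ≤ N‖M‖`; the symmetry of `G′(U)` is a HYPOTHESIS in §4–§5 (print p. 394) and a
THEOREM at def-Y's v4 record in §6 (dag-n06-j's repair R7); (3.42) at `Q′*δ` and (3.48) block-complete
remain the analytic inputs; count-neutral; NOT a node discharge; nothing continuum ∕ OS ∕ mass-gap.  Filed by dag-n06-i gen 6 (pub-ymgap N06 bundle F4,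
row 25); a NEW file; nothing landed is modified.
-/

namespace Literature.MathematicalPhysics.QuantumFieldTheory.Balaban1983to89.B9Ineq349SiteAdjoint

open Node00
open B6KLevelCensusIndexV1 (KIdx)
open B6Geom246MultiLevelBox (bset blkOf)
open B6Ineq268MultiLevelBox (W W_pos)
open B9Eq39Adjoint (R)
open B9Ineq349SiteReading (p349SiteY)
open B9Ineq349SiteComposite (lenB distB lenB_pos distB_nonneg etaS_pos Left342At Right342At Blk348At)
open B9Ineq349SiteFromBlocks (Thm31SiteSchemas Thm32BlkSchema stmt349Printed_site_of_blockSchemas)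
open B9Thm311ReadingCoords (trIP trIP_eq_re_trace IsSymmTr IsAdjTr)
open B9Thm311ReadingAtLetters (wB)
open B9Thm311AdjointAtLetters (isAdjTr_QpY_QpsY)
open B9Thm311DeltaPrimeSymm (re_trace_conjTranspose_mul_comm sum_trace_mul_cdsS deltaPrimeAY'_eq_of_inv_symm deltaPrimeAY'_isSymmTr)
open B7Prop2SpecialUnitary (specialUnitaryUnits specialUnitaryUnits_le_unitaryUnits)
open B6Ineq288MultiLevelTorus (dist_symm_geoBT)
open B9PinMembersKLevelV1 (MemberY geo9Y bg9Y)
open scoped Matrix Matrix.Norms.L2Operator ComplexConjugate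

noncomputable section

variable {d ℓ : ℕ} {hd : 1 ≤ d + 1} {hL : Odd (ℓ + 1) ∧ 1 < ℓ + 1} {b₀ b₁ : ℝ} {Mstar : ℕ} {N : ℕ}

/-! ## §1 Matrix analysis on `M_N(ℂ)` with the L²-operator norm -/

section MatrixFacts

/-- `|Re tr X| ≤ N·‖X‖` (the tree's `B11TracePairingLetters.abs_re_trace_le` at `n = Fin N`). [cite: Balaban1985Averaging, (19) p.21, bookkeeping] -/
theorem abs_re_trace_le_N (X : Matrix (Fin N) (Fin N) ℂ) : |(Matrix.trace X).re| ≤ N * ‖X‖ := by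
  simpa [Fintype.card_fin] using B11TracePairingLetters.abs_re_trace_le X

/-- `|Re tr(YᴴE)| ≤ N·‖Y‖·‖E‖`. [folklore] [cite: Balaban1985Averaging, (19)–(20) p.21] -/
theorem abs_re_trace_conjTranspose_mul_le (Y E : Matrix (Fin N) (Fin N) ℂ) : |(Matrix.trace (Yᴴ * E)).re| ≤ N * ‖Y‖ * ‖E‖ := by
  refine (abs_re_trace_le_N _).trans ?_
  rw [mul_assoc]
  refine mul_le_mul_of_nonneg_left ?_ (Nat.cast_nonneg N)
  calc ‖Yᴴ * E‖ ≤ ‖Yᴴ‖ * ‖E‖ := norm_mul_le _ _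
    _ = ‖Y‖ * ‖E‖ := by rw [Matrix.l2_opNorm_conjTranspose]

/-- `Re tr(XᴴX) = Σ_{ij}|X_{ij}|² ≥ ‖X‖²` (Hilbert–Schmidt dominates the operator norm; the tree's `MatrixNorms.opNorm_sq_le_sum_norm_sq`). [folklore] [cite: Balaban1985Averaging, (19)–(20) p.21] -/
theorem opNorm_sq_le_re_trace (X : Matrix (Fin N) (Fin N) ℂ) : ‖X‖ ^ 2 ≤ (Matrix.trace (Xᴴ * X)).re := by
  rw [← MatrixNorms.sum_norm_sq_eq_re_trace]
  exact MatrixNorms.opNorm_sq_le_sum_norm_sq X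

/-- ★ **THE OPERATOR NORM FROM TRACE PAIRINGS**: if `Re tr(FᴴX) ≤ c` for every `F` of operator norm `≤ 1` then `‖X‖ ≤ c` (test `F = X∕‖X‖`).
[folklore] [cite: Balaban1985Averaging, (19)–(20) p.21] -/
theorem opNorm_le_of_re_trace (X : Matrix (Fin N) (Fin N) ℂ) {c : ℝ} (hc : 0 ≤ c)
    (h : ∀ F : Matrix (Fin N) (Fin N) ℂ, ‖F‖ ≤ 1 → (Matrix.trace (Fᴴ * X)).re ≤ c) : ‖X‖ ≤ c := by
  by_cases hX : X = 0
  · rw [hX, norm_zero]; exact hc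
  · have hn : 0 < ‖X‖ := norm_pos_iff.2 hX
    set F : Matrix (Fin N) (Fin N) ℂ := ((‖X‖⁻¹ : ℝ) : ℂ) • X with hF
    have hF1 : ‖F‖ ≤ 1 := by
      rw [hF, norm_smul, Complex.norm_real, Real.norm_eq_abs, abs_of_pos (inv_pos.2 hn), inv_mul_cancel₀ hn.ne']
    have hkey := h F hF1
    have htr : (Matrix.trace (Fᴴ * X)).re = ‖X‖⁻¹ * (Matrix.trace (Xᴴ * X)).re := by
      rw [hF, Matrix.conjTranspose_smul, Matrix.smul_mul, Matrix.trace_smul]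
      rw [show star (((‖X‖⁻¹ : ℝ)) : ℂ) = (((‖X‖⁻¹ : ℝ)) : ℂ) from Complex.conj_ofReal _]
      rw [smul_eq_mul, Complex.re_ofReal_mul]
    rw [htr] at hkey
    have h2 := opNorm_sq_le_re_trace X
    have h3 : ‖X‖ = ‖X‖⁻¹ * ‖X‖ ^ 2 := by field_simp
    calc ‖X‖ = ‖X‖⁻¹ * ‖X‖ ^ 2 := h3
      _ ≤ ‖X‖⁻¹ * (Matrix.trace (Xᴴ * X)).re := mul_le_mul_of_nonneg_left h2 (inv_nonneg.2 hn.le)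
      _ ≤ c := hkey

end MatrixFacts

/-! ## §2 The trace pairing: symmetry, deltas, and (3.8) «D* is the adjoint of D» -/

section Pairing

variable {S : Type} [Fintype S]

/-- the pairing is symmetric (`Re tr(AᴴB) = Re tr(BᴴA)`). [cite: Balaban1985BackgroundPropagators, p.393 (scalar products), bookkeeping] -/
theorem trIP_comm (w : S → ℝ) (Φ Ψ : S → Matrix (Fin N) (Fin N) ℂ) : trIP w Φ Ψ = trIP w Ψ Φ := by
  rw [trIP_eq_re_trace, trIP_eq_re_trace]
  exact Finset.sum_congr rfl fun s _ => by rw [re_trace_conjTranspose_mul_comm (Ψ s) (Φ s)]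

/-- a delta in the LEFT slot picks one term: `⟨δ_s⊗F, Ψ⟩_w = w(s)·Re tr(FᴴΨ(s))`. [cite: Balaban1985BackgroundPropagators, p.393, bookkeeping] -/
theorem trIP_deltaY_left [DecidableEq S] (w : S → ℝ) (s : S) (F : Matrix (Fin N) (Fin N) ℂ) (Ψ : S → Matrix (Fin N) (Fin N) ℂ) :
    trIP w (deltaY s F) Ψ = w s * (Matrix.trace (Fᴴ * Ψ s)).re := by
  classical
  rw [trIP_eq_re_trace, Finset.sum_eq_single s]
  · simp [deltaY]
  · intro t _ ht; simp [deltaY, ht]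
  · intro h; exact absurd (Finset.mem_univ s) h

/-- a delta in the RIGHT slot: `⟨Φ, δ_s⊗E⟩_w = w(s)·Re tr(Φ(s)ᴴE)`. [cite: Balaban1985BackgroundPropagators, p.393, bookkeeping] -/
theorem trIP_deltaY_right [DecidableEq S] (w : S → ℝ) (s : S) (E : Matrix (Fin N) (Fin N) ℂ) (Φ : S → Matrix (Fin N) (Fin N) ℂ) :
    trIP w Φ (deltaY s E) = w s * (Matrix.trace ((Φ s)ᴴ * E)).re := by
  classical
  rw [trIP_eq_re_trace, Finset.sum_eq_single s]
  · simp [deltaY]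
  · intro t _ ht; simp [deltaY, ht]
  · intro h; exact absurd (Finset.mem_univ s) h

variable (i : KIdx d ℓ hd hL b₀ b₁)

/-- ★ **(3.8) FOR THE TRACE PAIRING: `⟨∇_{U,μ}Φ, Ψ⟩ = ⟨Φ, ∇*_{U,μ}Ψ⟩`** (unitary-valued `U`; the real part of dag-n06-j's complex trace identity
`B9Thm311DeltaPrimeSymm.sum_trace_mul_cdsS`, itself `B9Eq39Adjoint.sum_covD_mul` read through `(R(V)A)ᴴ = R(V)Aᴴ`).
[cite: Balaban1985BackgroundPropagators, (3.8) p.392 («D* is the adjoint of D»)] -/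
theorem trIP_cdS_left {U : CfgY (Matrix (Fin N) (Fin N) ℂ) i} (hU : ∀ μ x, (U μ x : Matrix (Fin N) (Fin N) ℂ) ∈ unitary (Matrix (Fin N) (Fin N) ℂ))
    (μ : Fin (d + 1)) (Φ Ψ : SiteY i → Matrix (Fin N) (Fin N) ℂ) :
    trIP (fun _ => (1 : ℝ)) (cdS i U μ Φ) Ψ = trIP (fun _ => (1 : ℝ)) Φ (cdsS i U μ Ψ) := by
  rw [trIP_eq_re_trace, trIP_eq_re_trace]
  simp only [one_mul]
  rw [← Complex.re_sum, ← Complex.re_sum, sum_trace_mul_cdsS i U hU μ Φ Ψ]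

end Pairing

/-! ## §3 The adjoint identity: the right factor of (3.25) against a delta IS the left factor at the swapped blocks -/

section Adjoint

variable (i : KIdx d ℓ hd hL b₀ b₁) {parS : SiteParY (Matrix (Fin N) (Fin N) ℂ) i} {Gp : SiteOpY (Matrix (Fin N) (Fin N) ℂ) i}
  {U : CfgY (Matrix (Fin N) (Fin N) ℂ) i}

/-- `wB` IS the block weight `W`. [cite: Balaban1984PropagatorsII, (2.69) p.235, bookkeeping] -/
theorem wB_eq (s : BlkY i) : wB i s = W i.D.toDomains s := rfl

/-- ★★ **THE ADJOINT IDENTITY**: for `G′(U)` symmetric and `Q′*(U)` the `W`-adjoint of `Q′(U)`,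
`W(y₂)·Re tr(Fᴴ·(Q′_UG′_Uφ)(y₂)) = ⟨G′_UQ′*_U(δ_{y₂}⊗F), φ⟩`. [cite: Balaban1985BackgroundPropagators, (3.25) p.394 (R orthogonal), p.393 (Q′* adjoint of Q′), (3.49) p.399] -/
theorem W_mul_re_trace_eq (hsymm : IsSymmTr (fun _ => (1 : ℝ)) (Gp U)) (hadj : IsAdjTr (fun _ => (1 : ℝ)) (wB i) (QpY i parS U) (QpsY i parS U))
    (y₂ : BlkY i) (F : Matrix (Fin N) (Fin N) ℂ) (φ : SiteY i → Matrix (Fin N) (Fin N) ℂ) :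
    W i.D.toDomains y₂ * (Matrix.trace (Fᴴ * QpY i parS U (Gp U φ) y₂)).re =
      trIP (fun _ => (1 : ℝ)) (Gp U (QpsY i parS U (deltaY y₂ F))) φ := by
  classical
  have h1 : W i.D.toDomains y₂ * (Matrix.trace (Fᴴ * QpY i parS U (Gp U φ) y₂)).re = trIP (wB i) (deltaY y₂ F) (QpY i parS U (Gp U φ)) := by
    rw [trIP_deltaY_left]; rfl
  rw [h1, trIP_comm, hadj, trIP_comm, hsymm]

variable (hU : ∀ μ x, (U μ x : Matrix (Fin N) (Fin N) ℂ) ∈ unitary (Matrix (Fin N) (Fin N) ℂ))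

/-- the identity on a delta input: `W(y₂)·Re tr(Fᴴ·(Q′G′(δ_{x′}⊗E))(y₂)) = Re tr(((G′Q′*(δ_{y₂}⊗F))(x′))ᴴ·E)`. [cite: Balaban1985BackgroundPropagators, (3.25) p.394, (3.49) p.399, bookkeeping] -/
theorem W_mul_re_trace_deltaY (hsymm : IsSymmTr (fun _ => (1 : ℝ)) (Gp U)) (hadj : IsAdjTr (fun _ => (1 : ℝ)) (wB i) (QpY i parS U) (QpsY i parS U))
    (y₂ : BlkY i) (F : Matrix (Fin N) (Fin N) ℂ) (x' : SiteY i) (E : Matrix (Fin N) (Fin N) ℂ) :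
    W i.D.toDomains y₂ * (Matrix.trace (Fᴴ * QpY i parS U (Gp U (deltaY x' E)) y₂)).re =
      (Matrix.trace ((Gp U (QpsY i parS U (deltaY y₂ F)) x')ᴴ * E)).re := by
  classical
  rw [W_mul_re_trace_eq i hsymm hadj, trIP_deltaY_right, one_mul]

include hU in
/-- … on a `∇*` input: `W(y₂)·Re tr(Fᴴ·(Q′G′∇*_ν(δ_{x′}⊗E))(y₂)) = Re tr(((∇_νG′Q′*(δ_{y₂}⊗F))(x′))ᴴ·E)` ((3.8)). [cite: Balaban1985BackgroundPropagators, (3.8) p.392, (3.25) p.394, (3.49) p.399] -/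
theorem W_mul_re_trace_cdsS_deltaY (hsymm : IsSymmTr (fun _ => (1 : ℝ)) (Gp U))
    (hadj : IsAdjTr (fun _ => (1 : ℝ)) (wB i) (QpY i parS U) (QpsY i parS U))
    (y₂ : BlkY i) (F : Matrix (Fin N) (Fin N) ℂ) (x' : SiteY i) (E : Matrix (Fin N) (Fin N) ℂ) (ν : Fin (d + 1)) :
    W i.D.toDomains y₂ * (Matrix.trace (Fᴴ * QpY i parS U (Gp U (cdsS i U ν (deltaY x' E))) y₂)).re =
      (Matrix.trace ((cdS i U ν (Gp U (QpsY i parS U (deltaY y₂ F))) x')ᴴ * E)).re := by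
  classical
  rw [W_mul_re_trace_eq i hsymm hadj, ← trIP_cdS_left i hU, trIP_deltaY_right, one_mul]

end Adjoint

/-! ## §4 `Right342At` from `Left342At` and the symmetries; row 25 from the LEFT schema -/

section RightFromLeft

variable (i : KIdx d ℓ hd hL b₀ b₁) {parS : SiteParY (Matrix (Fin N) (Fin N) ℂ) i} {Gp : SiteOpY (Matrix (Fin N) (Fin N) ℂ) i}
  {U : CfgY (Matrix (Fin N) (Fin N) ℂ) i}

set_option maxHeartbeats 400000 in
/-- ★★★ **THE ADJOINT-SIDE (3.42) SCHEMA FROM THE LEFT ONE AND THE SYMMETRIES**, constant `N·B₀`: for unitary-valued `U` and site transporters and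
`G′(U)` `trIP`-symmetric, `Left342At i parS Gp U B₀ δ₀ → Right342At i parS Gp U (N·B₀) δ₀`.  Proof: the adjoint identity of §3, `|Re tr(YᴴE)| ≤ N‖Y‖‖E‖`,
the LEFT bound at the swapped blocks (`d` symmetric), and `‖X‖ ≤ sup_{‖F‖≤1} Re tr(FᴴX)`.
[cite: Balaban1985BackgroundPropagators, (3.49) p.399 with (3.8) p.392, (3.18)–(3.19) p.393, (3.25) p.394, Thm 3.1 (3.42) p.397] -/
theorem right342At_of_left342At (hU : ∀ μ x, (U μ x : Matrix (Fin N) (Fin N) ℂ) ∈ unitary (Matrix (Fin N) (Fin N) ℂ))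
    (hpar : ∀ (s : BlkY i) (z : SiteY i), (parS U (blkCornerY i s) z : Matrix (Fin N) (Fin N) ℂ) ∈ unitary (Matrix (Fin N) (Fin N) ℂ))
    (hsymm : IsSymmTr (fun _ => (1 : ℝ)) (Gp U)) {B₀ δ₀ : ℝ} (hB₀ : 0 ≤ B₀) (hLe : Left342At i parS Gp U B₀ δ₀) :
    Right342At i parS Gp U (N * B₀) δ₀ := by
  have hadj := isAdjTr_QpY_QpsY i parS U hpar
  intro s₂ s' x' hx' E hE
  have hW := W_pos i.D.toDomains s₂
  have hη := etaS_pos i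
  have hds : distB i s₂ s' = distB i s' s₂ := dist_symm_geoBT (toKT i) s₂ s'
  -- the generic step: a trace identity + the LEFT bound ⇒ the operator-norm bound
  have step : ∀ (e : ℕ) (p : ℕ) (X : Matrix (Fin N) (Fin N) ℂ) (Y : Matrix (Fin N) (Fin N) ℂ → Matrix (Fin N) (Fin N) ℂ),
      (∀ F, W i.D.toDomains s₂ * (Matrix.trace (Fᴴ * X)).re = (Matrix.trace ((Y F)ᴴ * E)).re) →
      (∀ F, ‖F‖ ≤ 1 → etaS i ^ e * ‖Y F‖ ≤ B₀ * lenB i s' ^ p * Real.exp (-(δ₀ * distB i s' s₂))) →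
      W i.D.toDomains s₂ * (etaS i ^ e * ‖X‖) ≤ N * B₀ * lenB i s' ^ p * Real.exp (-(δ₀ * distB i s₂ s')) := by
    intro e p X Y hid hY
    have hηe : 0 < etaS i ^ e := pow_pos hη _
    have hc : 0 ≤ N * B₀ * lenB i s' ^ p * Real.exp (-(δ₀ * distB i s₂ s')) := by
      have := pow_nonneg (lenB_pos i s').le p; positivity
    -- bound on `‖X‖` via trace pairings
    have hX : ‖X‖ ≤ (W i.D.toDomains s₂ * etaS i ^ e)⁻¹ * (N * B₀ * lenB i s' ^ p * Real.exp (-(δ₀ * distB i s₂ s'))) := by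
      refine opNorm_le_of_re_trace X (by positivity) fun F hF => ?_
      have h1 : (Matrix.trace (Fᴴ * X)).re = (W i.D.toDomains s₂)⁻¹ * (Matrix.trace ((Y F)ᴴ * E)).re := by
        rw [← hid F, inv_mul_cancel_left₀ hW.ne']
      have h2 : |(Matrix.trace ((Y F)ᴴ * E)).re| ≤ N * ‖Y F‖ := by
        refine (abs_re_trace_conjTranspose_mul_le _ _).trans ?_
        have : 0 ≤ (N : ℝ) * ‖Y F‖ := by positivity
        calc (N : ℝ) * ‖Y F‖ * ‖E‖ ≤ N * ‖Y F‖ * 1 := mul_le_mul_of_nonneg_left hE this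
          _ = N * ‖Y F‖ := mul_one _
      have h3 : (N : ℝ) * ‖Y F‖ ≤ (etaS i ^ e)⁻¹ * (N * B₀ * lenB i s' ^ p * Real.exp (-(δ₀ * distB i s₂ s'))) := by
        have h4 := hY F hF
        rw [← hds] at h4
        calc (N : ℝ) * ‖Y F‖ = (etaS i ^ e)⁻¹ * (N * (etaS i ^ e * ‖Y F‖)) := by field_simp
          _ ≤ (etaS i ^ e)⁻¹ * (N * (B₀ * lenB i s' ^ p * Real.exp (-(δ₀ * distB i s₂ s')))) :=
              mul_le_mul_of_nonneg_left (mul_le_mul_of_nonneg_left h4 (Nat.cast_nonneg N)) (inv_nonneg.2 hηe.le)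
          _ = _ := by ring
      calc (Matrix.trace (Fᴴ * X)).re = (W i.D.toDomains s₂)⁻¹ * (Matrix.trace ((Y F)ᴴ * E)).re := h1
        _ ≤ (W i.D.toDomains s₂)⁻¹ * (N * ‖Y F‖) :=
            mul_le_mul_of_nonneg_left ((le_abs_self _).trans h2) (inv_nonneg.2 hW.le)
        _ ≤ (W i.D.toDomains s₂)⁻¹ * ((etaS i ^ e)⁻¹ * (N * B₀ * lenB i s' ^ p * Real.exp (-(δ₀ * distB i s₂ s')))) :=
            mul_le_mul_of_nonneg_left h3 (inv_nonneg.2 hW.le)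
        _ = _ := by ring
    calc W i.D.toDomains s₂ * (etaS i ^ e * ‖X‖)
        ≤ W i.D.toDomains s₂ * (etaS i ^ e * ((W i.D.toDomains s₂ * etaS i ^ e)⁻¹ * (N * B₀ * lenB i s' ^ p * Real.exp (-(δ₀ * distB i s₂ s'))))) :=
          mul_le_mul_of_nonneg_left (mul_le_mul_of_nonneg_left hX hηe.le) hW.le
      _ = N * B₀ * lenB i s' ^ p * Real.exp (-(δ₀ * distB i s₂ s')) := by field_simp
  refine ⟨?_, fun ν => ?_⟩
  · -- `b = 0`
    have h := step 2 2 (QpY i parS U (Gp U (deltaY x' E)) s₂) (fun F => Gp U (QpsY i parS U (deltaY s₂ F)) x')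
      (fun F => W_mul_re_trace_deltaY i hsymm hadj s₂ F x' E) (fun F hF => (hLe s' s₂ F hF x' hx').1)
    simpa [mul_assoc] using h
  · -- `b = 1`
    have h := step 1 1 (QpY i parS U (Gp U (cdsS i U ν (deltaY x' E))) s₂) (fun F => cdS i U ν (Gp U (QpsY i parS U (deltaY s₂ F))) x')
      (fun F => W_mul_re_trace_cdsS_deltaY i hU hsymm hadj s₂ F x' E ν)
      (fun F hF => by rw [pow_one, pow_one]; exact (hLe s' s₂ F hF x' hx').2 ν)
    simpa [mul_assoc] using h

end RightFromLeft

/-! ## §5 Row 25 at the record fibre from the LEFT schema, the (3.48) schema and the symmetry of `G′(U)` -/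

section Record

variable {G : Subgroup (Matrix (Fin N) (Fin N) ℂ)ˣ}

/-- **THE LEFT (3.42) INPUT WITH THE SYMMETRY OF `G′(U)` AS A FAMILY STATEMENT** (Thm 3.1's printed prefix): for every member above the threshold,
every admissible `α₀` and every `U` in (3.35), the LEFT schema with `B₀, δ₀`, `G′(U)` `trIP`-symmetric (print p. 394: `Δ′_a(U)` symmetric positive),
and the site transporters `G`-valued.  Hypothesis shape. [cite: Balaban1985BackgroundPropagators, Thm 3.1 (3.42) p.397, (3.21)–(3.25) p.394, (3.35) p.396, (3.40) p.397] -/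
def Thm31LeftSchemaSymm (c35 : ℝ) (𝔏 : ∀ x : MemberY d ℓ hd hL b₀ b₁ Mstar, CovLettersY (Matrix (Fin N) (Fin N) ℂ) x) : Prop :=
  ∃ M₁ δ₀ a₀ B₀ : ℝ, 0 < M₁ ∧ 0 < δ₀ ∧ 0 < a₀ ∧ 0 < B₀ ∧
    ∀ x : MemberY d ℓ hd hL b₀ b₁ Mstar, M₁ ≤ (geo9Y x).M → ∀ α₀ : ℝ, 0 < α₀ → (geo9Y x).M * α₀ ≤ a₀ →
      ∀ U : (bg9Y (Matrix (Fin N) (Fin N) ℂ) G x).Cfg, (bg9Y (Matrix (Fin N) (Fin N) ℂ) G x).Reg335 c35 α₀ U →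
        Left342At x.toKIdx (𝔏 x).parS (𝔏 x).Gp U B₀ δ₀ ∧ IsSymmTr (fun _ => (1 : ℝ)) ((𝔏 x).Gp U) ∧
          ∀ z w : SiteY x.toKIdx, (𝔏 x).parS U z w ∈ G

/-- ★★★ **`Thm31SiteSchemas` FROM THE LEFT SCHEMA AND THE SYMMETRIES** for `G ≤ U(N)` ((3.35) makes `U` G-valued): constant `max 1 N · B₀`.
[cite: Balaban1985BackgroundPropagators, Thm 3.1 (3.42) p.397, (3.25) p.394, (3.35) p.396] -/
theorem thm31SiteSchemas_of_left (hG : G ≤ B7Prop2Explicit.unitaryUnits (Matrix (Fin N) (Fin N) ℂ)) {c35 : ℝ}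
    (𝔏 : ∀ x : MemberY d ℓ hd hL b₀ b₁ Mstar, CovLettersY (Matrix (Fin N) (Fin N) ℂ) x) (h : Thm31LeftSchemaSymm (G := G) c35 𝔏) :
    Thm31SiteSchemas (Matrix (Fin N) (Fin N) ℂ) G c35 𝔏 := by
  obtain ⟨M₁, δ₀, a₀, B₀, hM₁, hδ₀, ha₀, hB₀, H⟩ := h
  refine ⟨M₁, δ₀, a₀, max 1 (N : ℝ) * B₀, hM₁, hδ₀, ha₀, by positivity, fun x hM α₀ hα₀ hMa U hU => ?_⟩
  obtain ⟨hLe, hsymm, hparG⟩ := H x hM α₀ hα₀ hMa U hU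
  have hUG : ∀ μ y, U μ y ∈ G := hU.1.1
  have hUu : ∀ μ y, (U μ y : Matrix (Fin N) (Fin N) ℂ) ∈ unitary (Matrix (Fin N) (Fin N) ℂ) := fun μ y => hG (hUG μ y)
  have hparu : ∀ (s : BlkY x.toKIdx) (z : SiteY x.toKIdx),
      ((𝔏 x).parS U (blkCornerY x.toKIdx s) z : Matrix (Fin N) (Fin N) ℂ) ∈ unitary (Matrix (Fin N) (Fin N) ℂ) :=
    fun s z => hG (hparG _ z)
  have hR := right342At_of_left342At x.toKIdx hUu hparu hsymm hB₀.le hLe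
  -- monotonicity of both schemas in the constant: `B₀, N·B₀ ≤ max 1 N · B₀`
  have hle₁ : B₀ ≤ max 1 (N : ℝ) * B₀ := by nlinarith [le_max_left (1 : ℝ) N]
  have hle₂ : (N : ℝ) * B₀ ≤ max 1 (N : ℝ) * B₀ := mul_le_mul_of_nonneg_right (le_max_right _ _) hB₀.le
  refine ⟨fun s s₁ F hF z hz => ⟨?_, fun μ => ?_⟩, fun s₂ s' x' hx' E hE => ⟨?_, fun ν => ?_⟩⟩
  · exact (hLe s s₁ F hF z hz).1.trans (by
      have := (lenB_pos x.toKIdx s).le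
      exact mul_le_mul_of_nonneg_right (mul_le_mul_of_nonneg_right hle₁ (pow_nonneg this 2)) (Real.exp_nonneg _))
  · exact ((hLe s s₁ F hF z hz).2 μ).trans (by
      have := (lenB_pos x.toKIdx s).le
      exact mul_le_mul_of_nonneg_right (mul_le_mul_of_nonneg_right hle₁ this) (Real.exp_nonneg _))
  · exact (hR s₂ s' x' hx' E hE).1.trans (by
      have := (lenB_pos x.toKIdx s').le
      exact mul_le_mul_of_nonneg_right (mul_le_mul_of_nonneg_right hle₂ (pow_nonneg this 2)) (Real.exp_nonneg _))
  · exact ((hR s₂ s' x' hx' E hE).2 ν).trans (by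
      have := (lenB_pos x.toKIdx s').le
      exact mul_le_mul_of_nonneg_right (mul_le_mul_of_nonneg_right hle₂ this) (Real.exp_nonneg _))

/-- ★★★ **ROW 25 AT THE RECORD FIBRE FROM THE LEFT (3.42) SCHEMA, THE BLOCK-COMPLETE (3.48) AND THE SYMMETRY OF `G′(U)`** (`G ≤ U(N)`):
`B9.Stmt349Printed (d+1) c35 geo9Y (bg9Y (M_N(ℂ)) G) (x ↦ p349SiteY _ G x (𝔏 x))`. [cite: Balaban1985BackgroundPropagators, (3.49) p.399; Thm 3.1 (3.42) p.397; Thm 3.2 (3.48) p.398; (3.25) p.394] -/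
theorem stmt349Printed_site_of_leftSchema_symm (hG : G ≤ B7Prop2Explicit.unitaryUnits (Matrix (Fin N) (Fin N) ℂ)) {c35 : ℝ}
    (𝔏 : ∀ x : MemberY d ℓ hd hL b₀ b₁ Mstar, CovLettersY (Matrix (Fin N) (Fin N) ℂ) x)
    (h31 : Thm31LeftSchemaSymm (G := G) c35 𝔏) (h32 : Thm32BlkSchema (Matrix (Fin N) (Fin N) ℂ) G c35 𝔏) :
    B9.Stmt349Printed (d + 1) c35 (geo9Y (d := d) (ℓ := ℓ) (hd := hd) (hL := hL) (b₀ := b₀) (b₁ := b₁) (Mstar := Mstar))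
      (bg9Y (Matrix (Fin N) (Fin N) ℂ) G) (fun x => p349SiteY (Matrix (Fin N) (Fin N) ℂ) G x (𝔏 x)) :=
  stmt349Printed_site_of_blockSchemas 𝔏 (thm31SiteSchemas_of_left hG 𝔏 h31) h32

end Record

/-! ## §6 At def-Y's v4 record (symmetrised transporters): the symmetry of `G′(U)` DISCHARGED, row 25 from the LEFT schema and (3.48) only -/

section RecordV4

variable {S : Type} [Fintype S]

/-- the `Ring.inverse` of a `trIP`-symmetric operator is `trIP`-symmetric (a unit: `⟨T⁻¹Φ, Ψ⟩ = ⟨T⁻¹Φ, TT⁻¹Ψ⟩ = ⟨TT⁻¹Φ, T⁻¹Ψ⟩`; a non-unit: the inverse is `0`).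
[cite: Balaban1985BackgroundPropagators, (3.25) p.394–395 («G′ = (Δ′_a)⁻¹», Δ′_a symmetric positive), bookkeeping] -/
theorem isSymmTr_ringInverse (w : S → ℝ) {T : (S → Matrix (Fin N) (Fin N) ℂ) →ₗ[ℂ] (S → Matrix (Fin N) (Fin N) ℂ)} (hT : IsSymmTr w T) :
    IsSymmTr w (Ring.inverse T) := by
  intro Φ Ψ
  by_cases hu : IsUnit T
  · have h1 : Ψ = T (Ring.inverse T Ψ) := (B9Thm311ReadingCoords.apply_inverse_of_isUnit hu Ψ).symm
    have h2 : Φ = T (Ring.inverse T Φ) := (B9Thm311ReadingCoords.apply_inverse_of_isUnit hu Φ).symm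
    conv_lhs => rw [h1]
    conv_rhs => rw [h2]
    exact (hT _ _).symm
  · rw [Ring.inverse_non_unit _ hu, LinearMap.zero_apply, LinearMap.zero_apply, trIP_comm, B9Thm311ReadingCoords.trIP_zero_right,
      B9Thm311ReadingCoords.trIP_zero_right]

variable {d ℓ : ℕ} {hd : 1 ≤ d + 1} {hL : Odd (ℓ + 1) ∧ 1 < ℓ + 1} {b₀ b₁ : ℝ}

/-- ★★ **def-Y's v4 `G′(U) = (Δ′_a(U))⁻¹` OVER THE SYMMETRISED TRANSPORTERS IS `trIP`-SYMMETRIC** for a `G`-valued configuration, `G ≤ U(N)`: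
`parSymY` is inverse-symmetric, so def-Y's `deltaPrimeAY … (parSymY …)` IS dag-n06-j's repaired `deltaPrimeAY'` (`deltaPrimeAY'_eq_of_inv_symm`), which is
symmetric (`deltaPrimeAY'_isSymmTr`); the inverse inherits it. [cite: Balaban1985BackgroundPropagators, (3.24)–(3.25) pp.394–395, (3.35) p.396] -/
theorem isSymmTr_GpY_parSymY (i : KIdx d ℓ hd hL b₀ b₁) {G : Subgroup (Matrix (Fin N) (Fin N) ℂ)ˣ}
    (hG : G ≤ B7Prop2Explicit.unitaryUnits (Matrix (Fin N) (Fin N) ℂ)) {U : CfgY (Matrix (Fin N) (Fin N) ℂ) i} (hU : ∀ μ x, U μ x ∈ G) :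
    IsSymmTr (fun _ => (1 : ℝ)) (GpY i (parSymY i) U) := by
  have hΔ : IsSymmTr (fun _ => (1 : ℝ)) (deltaPrimeAY i (parSymY i) U) := by
    rw [← deltaPrimeAY'_eq_of_inv_symm i (parSymY i) U (parSymY_inv_symm U)]
    exact deltaPrimeAY'_isSymmTr i hG (parSymY i) U (fun z w => parSymY_mem i hU z w) hU
  exact isSymmTr_ringInverse _ hΔ

variable {Mstar : ℕ}

/-- **THE LEFT (3.42) INPUT ALONE AS A FAMILY STATEMENT** (Thm 3.1's prefix; no symmetry conjunct). [cite: Balaban1985BackgroundPropagators, Thm 3.1 (3.42) p.397 with (3.25) p.394] -/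
def Thm31LeftSchema {G : Subgroup (Matrix (Fin N) (Fin N) ℂ)ˣ} (c35 : ℝ)
    (𝔏 : ∀ x : MemberY d ℓ hd hL b₀ b₁ Mstar, CovLettersY (Matrix (Fin N) (Fin N) ℂ) x) : Prop :=
  ∃ M₁ δ₀ a₀ B₀ : ℝ, 0 < M₁ ∧ 0 < δ₀ ∧ 0 < a₀ ∧ 0 < B₀ ∧
    ∀ x : MemberY d ℓ hd hL b₀ b₁ Mstar, M₁ ≤ (geo9Y x).M → ∀ α₀ : ℝ, 0 < α₀ → (geo9Y x).M * α₀ ≤ a₀ →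
      ∀ U : (bg9Y (Matrix (Fin N) (Fin N) ℂ) G x).Cfg, (bg9Y (Matrix (Fin N) (Fin N) ℂ) G x).Reg335 c35 α₀ U →
        Left342At x.toKIdx (𝔏 x).parS (𝔏 x).Gp U B₀ δ₀

/-- ★★ **AT def-Y's v4 RECORD THE SYMMETRY AND TRANSPORT CONJUNCTS ARE THEOREMS**: `Thm31LeftSchema → Thm31LeftSchemaSymm` for `lettersYOfRecordV4`
(`parS = parSymY`, `Gp = GpY … (parSymY …)`; (3.35) gives `U` G-valued; `G ≤ U(N)`). [cite: Balaban1985BackgroundPropagators, (3.25) p.394, (3.35) p.396, (3.40) p.397] -/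
theorem thm31LeftSchemaSymm_lettersYOfRecordV4 {G : Subgroup (Matrix (Fin N) (Fin N) ℂ)ˣ} (hG : G ≤ B7Prop2Explicit.unitaryUnits (Matrix (Fin N) (Fin N) ℂ))
    (θ : Stage3Params) (Mstar : ℕ) (𝔯 : ResY N θ Mstar) {c35 : ℝ}
    (h : Thm31LeftSchema (G := G) c35 (lettersYOfRecordV4 N θ Mstar 𝔯)) :
    Thm31LeftSchemaSymm (G := G) c35 (lettersYOfRecordV4 N θ Mstar 𝔯) := by
  obtain ⟨M₁, δ₀, a₀, B₀, hM₁, hδ₀, ha₀, hB₀, H⟩ := h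
  refine ⟨M₁, δ₀, a₀, B₀, hM₁, hδ₀, ha₀, hB₀, fun x hM α₀ hα₀ hMa U hU => ⟨H x hM α₀ hα₀ hMa U hU, ?_, ?_⟩⟩
  · have hUG : ∀ μ y, U μ y ∈ G := hU.1.1
    exact isSymmTr_GpY_parSymY x.toKIdx hG hUG
  · intro z w
    exact parSymY_mem x.toKIdx hU.1.1 z w

/-- ★★★ **ROW 25 AT def-Y's v4 RECORD FROM THE LEFT (3.42) SCHEMA AND THE BLOCK-COMPLETE (3.48) ONLY** (`G = SU(N) ≤ U(N)`): the adjoint side AND the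
symmetry of `G′(U)` are now theorems. [cite: Balaban1985BackgroundPropagators, (3.49) p.399; Thm 3.1 (3.42) p.397; Thm 3.2 (3.48) p.398; (3.25) p.394] -/
theorem stmt349Printed_site_lettersYOfRecordV4_of_left (θ : Stage3Params) (Mstar : ℕ) (𝔯 : ResY N θ Mstar) {c35 : ℝ}
    (h31 : Thm31LeftSchema (G := specialUnitaryUnits (Fin N)) c35 (lettersYOfRecordV4 N θ Mstar 𝔯))
    (h32 : Thm32BlkSchema (Matrix (Fin N) (Fin N) ℂ) (specialUnitaryUnits (Fin N)) c35 (lettersYOfRecordV4 N θ Mstar 𝔯)) :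
    B9.Stmt349Printed (θ.d₆ + 1) c35 (geo9Y (d := θ.d₆) (ℓ := θ.ℓ₆) (hd := θ.hd') (hL := θ.hL') (b₀ := θ.b₀) (b₁ := θ.b₁) (Mstar := Mstar))
      (bg9Y (Matrix (Fin N) (Fin N) ℂ) (specialUnitaryUnits (Fin N))) (fun x => p349SiteY (Matrix (Fin N) (Fin N) ℂ) (specialUnitaryUnits (Fin N)) x
        (lettersYOfRecordV4 N θ Mstar 𝔯 x)) :=
  stmt349Printed_site_of_leftSchema_symm specialUnitaryUnits_le_unitaryUnits _
    (thm31LeftSchemaSymm_lettersYOfRecordV4 specialUnitaryUnits_le_unitaryUnits θ Mstar 𝔯 h31) h32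

end RecordV4

end

end Literature.MathematicalPhysics.QuantumFieldTheory.Balaban1983to89.B9Ineq349SiteAdjoint
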